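import Literature.Analysis.Calculus.LogCutoff
import Summits.AnomalousDissipation.AnomalousDissipation.Theorems.SawtoothPulseCascadeK1LocalisedCascadeLedgerGeometric
import Summits.AnomalousDissipation.AnomalousDissipation.Theorems.SawtoothPulseCascadeK1LocalisedCascadeConcreteStepH
import Summits.AnomalousDissipation.AnomalousDissipation.Theorems.SawtoothPulseCascadeK1LocalisedCascadeLedgerMajorantsSum

/-!
# K1loc, line `Spectral` / SeqCone — helper: THE H HALF-SLOTS OF THE CASCADE LEDGER DECAY GEOMETRICALLY (S-B assembly)

Helper file of the prover lane on the crux `K1LocalisedCascade` (stmt-AnomalousDissipation-19491), route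
`SawtoothPulseCascade` (S-B/S-C assembly seat).  For the concrete cascade at the crux point (`N₀ = 1`, `ρN = 2`,
`d = 2`; `5 ≤ γ ≤ 8`, `0 < δ₀ ≤ 1/4`) and the tracked product-symbol family along the schedule of `…LedgerSchedule` /
`…LedgerCutoffSchedule` (radii `L_j = L₀ρ^j`, envelopes `R_j = 2L₀Γ^j`, widths `w_j`, cut-off widths `ε_j = 1/(1000Γ^j)`,
flat-layer depths `M_j`), this file instantiates ad-k1loc-p3's `…K1Ledger.cascade_ledger_step_H_concrete` at every phase
and majorises its explicit errors (`…LedgerMajorantsSum`): **`exists_geometric_hstepH`** — there are `K_ε, K_ζ ≥ 0` such that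
for every `0 < κ ≤ 1`, every classical cascade scalar `w` from `θ₀` (`|θ₀| ≤ B`) and every phase `j < J_{γ²−3}(κ)` the H
half-slot inequality `‖μⱽ_j(D)w(t₁)‖² ≤ (‖μᴴ_j(D)w(t₀)‖ + ε)² + ζ` holds with `ε ≤ K_ε θ^j`, `ζ ≤ K_ζ θ^j`,
`θ = (max(16/ρ, 1/2))^{1/4} < 1` — literally the hypothesis `hstepH` of `…K1Ledger.highModeConcentration_of_geometric_ledger'`
(with `i₀ = 0`).  The constants are existential (they descend from the tree's existential smooth-step bounds) but
uniform.  No definitions; no statement about the stub.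
[cite: ElgindiLissMattingly2025, §1.2.1–§1.2.2 and §3.1] [cite: BedrossianCotiZelati2017, §2] [problem: turb]
-/

-- `Summit.<Summit>.<Problem>`: single-conjunct summit, the duplicate namespace segment is deliberate.
set_option linter.dupNamespace false

noncomputable section

namespace Summit.AnomalousDissipation.AnomalousDissipation.Theorems.SawtoothPulseCascade.K1Ledger

open MeasureTheory Set Filter Topology UnitAddTorus Function
open Literature.Analysis Literature.Analysis.FunctionSpaces Literature.Analysis.FunctionSpaces.Torus
open Literature.Analysis.FluidPDE.SawtoothCascade Literature.Analysis.FluidPDE.SawtoothCascade.CascadeParams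
open Summit.AnomalousDissipation.AnomalousDissipation.Theorems.SawtoothPulseCascade.K1Symbol

/-- The slot clock is at most one: `tHalf j = 45/(π⁴(j+1)⁴) ≤ 1`. [folklore] -/
theorem tHalf_le_one (j : ℕ) : tHalf j ≤ 1 := by
  unfold tHalf
  have hπ := Real.pi_gt_three
  have h4 : (81 : ℝ) ≤ Real.pi ^ 4 := by
    have := pow_le_pow_left₀ (by norm_num : (0:ℝ) ≤ 3) hπ.le 4
    norm_num at this; exact this
  have hj : (1 : ℝ) ≤ ((j : ℝ) + 1) ^ 4 := one_le_pow₀ (by have : (0:ℝ) ≤ j := Nat.cast_nonneg j; linarith)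
  rw [div_le_one (by positivity)]
  nlinarith

/-- `κ·r^{2j} ≤ 1` on the ledger's phases `j < J_r(κ)` (`0 < κ ≤ 1`, `1 < r`). [cite: ElgindiLissMattingly2025, §1.2.1] -/
theorem kappa_mul_rate_pow_le_one {r κ : ℝ} (hr : 1 < r) (hκ : 0 < κ) (hκ1 : κ ≤ 1) {j : ℕ} (hj : j < Jrate r κ) :
    κ * r ^ (2 * j) ≤ 1 := by
  have h := mul_pow_lt_pow_of_lt_Jrate_add hr hκ hκ1 (A := 0) (by simpa using hj)
  rw [mul_zero, pow_zero] at h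
  exact h.le

section Cascade

variable (P : CascadeParams)

/-- **The H half-slots of the cascade ledger decay geometrically.**  See the module docstring.  The tracked symbols are
`μᴴ_j = 1 − g^S_{L_j}·g^env_{R_j,w_j}` and `μⱽ_j = 1 − g^M_{L_j/(1+ε)}·g^env_{R′_j,w_j}` at the scheduled parameters
(`ε = 1/250`, `a = 13/10`, `ε_a = 1/20`, `a₂ = 29/20`, `L_j = L₀ρ^j`, `R_j = 2L₀Γ^j`, `w_j = L_j/(20γ(1+1/250))`,
`R′_j = (1+γ)(R_j + w_j) + ½`). [cite: ElgindiLissMattingly2025, §1.2.1–§1.2.2 and §3.1] [cite: BedrossianCotiZelati2017, §2] -/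
theorem exists_geometric_hstepH (hγ : 5 ≤ P.γ) (hγ' : P.γ ≤ 8) (hδ₀ : 0 < P.δ₀) (hδ₀' : P.δ₀ ≤ 1 / 4)
    (hd : P.d = 2) (hN₀ : P.N₀ = 1) (hρN : P.ρN = 2) {L₀ : ℝ} (hL₀ : 1000 ≤ L₀)
    {θ₀ : UnitAddTorus (Fin 2) → ℝ} {B : ℝ} (hB : ∀ x, |θ₀ x| ≤ B) :
    ∃ Kε Kζ : ℝ, 0 ≤ Kε ∧ 0 ≤ Kζ ∧ ∀ κ ∈ Ioc (0 : ℝ) 1, ∀ w : ℝ → UnitAddTorus (Fin 2) → ℝ,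
      FluidPDE.Torus.IsClassicalScalarTransportOn (Ico 0 1) κ P.field w → w 0 = θ₀ →
        ∀ j : ℕ, 0 ≤ j → j < Jrate (P.γ ^ 2 - 3) κ → ∃ ε ζ : ℝ, 0 ≤ ε ∧
          ε ≤ Kε * Real.sqrt (Real.sqrt (max (16 / ((P.γ ^ 2 - 5 / 2) / (1 + 1 / 250) ^ 2 -
            1 / (2 * (1 + 1 / 250) * L₀))) (1 / 2))) ^ j ∧ 0 ≤ ζ ∧
          ζ ≤ Kζ * Real.sqrt (Real.sqrt (max (16 / ((P.γ ^ 2 - 5 / 2) / (1 + 1 / 250) ^ 2 -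
            1 / (2 * (1 + 1 / 250) * L₀))) (1 / 2))) ^ j ∧
          ∑' k : Fin 2 → ℤ, (1 - Real.smoothTransition ((|((k 0 : ℤ) : ℝ)| -
              L₀ * ((P.γ ^ 2 - 5 / 2) / (1 + 1 / 250) ^ 2 - 1 / (2 * (1 + 1 / 250) * L₀)) ^ j / (1 + 1 / 250)) /
            (1 / 250 * (L₀ * ((P.γ ^ 2 - 5 / 2) / (1 + 1 / 250) ^ 2 - 1 / (2 * (1 + 1 / 250) * L₀)) ^ j / (1 + 1 / 250)))) *
          (1 - Real.smoothTransition ((P.γ * |((k 1 : ℤ) : ℝ) + P.γ * ((k 0 : ℤ) : ℝ)| - 29 / 20 * |((k 0 : ℤ) : ℝ)|) /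
              (1 / 20 * (L₀ * ((P.γ ^ 2 - 5 / 2) / (1 + 1 / 250) ^ 2 - 1 / (2 * (1 + 1 / 250) * L₀)) ^ j / (1 + 1 / 250)))) *
            Real.smoothTransition ((P.γ * |((k 1 : ℤ) : ℝ) - P.γ * ((k 0 : ℤ) : ℝ)| - 29 / 20 * |((k 0 : ℤ) : ℝ)|) /
              (1 / 20 * (L₀ * ((P.γ ^ 2 - 5 / 2) / (1 + 1 / 250) ^ 2 - 1 / (2 * (1 + 1 / 250) * L₀)) ^ j / (1 + 1 / 250))))) *
        ((1 - Real.smoothTransition ((|((k 0 : ℤ) : ℝ)| -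
              ((1 + P.γ) * (2 * L₀ * ((1 + P.γ) ^ 2 + 1) ^ j +
                L₀ * ((P.γ ^ 2 - 5 / 2) / (1 + 1 / 250) ^ 2 - 1 / (2 * (1 + 1 / 250) * L₀)) ^ j / (20 * P.γ * (1 + 1 / 250))) +
                1 / 2)) /
            (L₀ * ((P.γ ^ 2 - 5 / 2) / (1 + 1 / 250) ^ 2 - 1 / (2 * (1 + 1 / 250) * L₀)) ^ j / (20 * P.γ * (1 + 1 / 250))))) *
          (1 - Real.smoothTransition ((|((k 1 : ℤ) : ℝ)| -
              ((1 + P.γ) * (2 * L₀ * ((1 + P.γ) ^ 2 + 1) ^ j +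
                L₀ * ((P.γ ^ 2 - 5 / 2) / (1 + 1 / 250) ^ 2 - 1 / (2 * (1 + 1 / 250) * L₀)) ^ j / (20 * P.γ * (1 + 1 / 250))) +
                1 / 2)) /
            (L₀ * ((P.γ ^ 2 - 5 / 2) / (1 + 1 / 250) ^ 2 - 1 / (2 * (1 + 1 / 250) * L₀)) ^ j / (20 * P.γ * (1 + 1 / 250)))))))
              ^ 2 * ‖mFourierCoeff (fun x => (w (tStart j + tHalf j) x : ℂ)) k‖ ^ 2 ≤
            (Real.sqrt (∑' k : Fin 2 → ℤ, (1 - Real.smoothTransition ((|((k 0 : ℤ) : ℝ)| - L₀ * ((P.γ ^ 2 - 5 / 2) / (1 + 1 / 250) ^ 2 - 1 / (2 * (1 + 1 / 250) * L₀)) ^ j) /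
            (1 / 250 * (L₀ * ((P.γ ^ 2 - 5 / 2) / (1 + 1 / 250) ^ 2 - 1 / (2 * (1 + 1 / 250) * L₀)) ^ j))) *
          (1 - Real.smoothTransition ((P.γ * |((k 1 : ℤ) : ℝ)| - 13 / 10 * |((k 0 : ℤ) : ℝ)|) /
            (1 / 20 * (L₀ * ((P.γ ^ 2 - 5 / 2) / (1 + 1 / 250) ^ 2 - 1 / (2 * (1 + 1 / 250) * L₀)) ^ j)))) *
        ((1 - Real.smoothTransition ((|((k 0 : ℤ) : ℝ)| - 2 * L₀ * ((1 + P.γ) ^ 2 + 1) ^ j) /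
            (L₀ * ((P.γ ^ 2 - 5 / 2) / (1 + 1 / 250) ^ 2 - 1 / (2 * (1 + 1 / 250) * L₀)) ^ j / (20 * P.γ * (1 + 1 / 250))))) *
          (1 - Real.smoothTransition ((|((k 1 : ℤ) : ℝ)| - 2 * L₀ * ((1 + P.γ) ^ 2 + 1) ^ j) /
            (L₀ * ((P.γ ^ 2 - 5 / 2) / (1 + 1 / 250) ^ 2 - 1 / (2 * (1 + 1 / 250) * L₀)) ^ j / (20 * P.γ * (1 + 1 / 250)))))))
                ^ 2 * ‖mFourierCoeff (fun x => (w (tStart j) x : ℂ)) k‖ ^ 2) + ε) ^ 2 + ζ := by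
  -- elementary facts
  have hγ0 : 0 < P.γ := by linarith
  have hL0 : 0 < L₀ := by linarith
  have hd0 : 0 < P.d := by rw [hd]; norm_num
  have hr1 : 1 < (P.γ ^ 2 - 3) := one_lt_rate hγ
  have hrρ : (P.γ ^ 2 - 3) < ((P.γ ^ 2 - 5 / 2) / (1 + 1 / 250) ^ 2 - 1 / (2 * (1 + 1 / 250) * L₀)) := rate_lt_rho hγ hγ' hL₀
  have hρ0 : 0 < ((P.γ ^ 2 - 5 / 2) / (1 + 1 / 250) ^ 2 - 1 / (2 * (1 + 1 / 250) * L₀)) := rho_pos hγ hγ' hL₀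
  have hr22 : (22 : ℝ) ≤ (P.γ ^ 2 - 3) := by nlinarith
  have hρ16 : 16 < ((P.γ ^ 2 - 5 / 2) / (1 + 1 / 250) ^ 2 - 1 / (2 * (1 + 1 / 250) * L₀)) := by linarith
  have hρr2 : ((P.γ ^ 2 - 5 / 2) / (1 + 1 / 250) ^ 2 - 1 / (2 * (1 + 1 / 250) * L₀)) ≤ (P.γ ^ 2 - 3) ^ 2 := by
    have h1 := rho_le_lambda (γ := P.γ) hL₀
    have h2 : (P.γ ^ 2 - 5 / 2) / (1 + 1 / 250) ^ 2 ≤ P.γ ^ 2 - 5 / 2 := div_le_self (by nlinarith) (by norm_num)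
    nlinarith
  have hG2 : 2 ≤ ((1 + P.γ) ^ 2 + 1) := by nlinarith
  obtain ⟨hΘ16, hΘhalf⟩ := le_theta0_sq ((P.γ ^ 2 - 5 / 2) / (1 + 1 / 250) ^ 2 - 1 / (2 * (1 + 1 / 250) * L₀))
  obtain ⟨hΘpos, hΘlt1⟩ := theta0_pos_lt_one hρ16
  obtain ⟨hΘθ, hθ1, hθ0⟩ := theta_facts hρ16
  have hMb0 : 0 ≤ Real.sqrt (2 * Real.log (2000 * ((1 + P.γ) ^ 2 + 1))) := Real.sqrt_nonneg _
  have hE0 : 0 ≤ FluidPDE.Torus.scalarL2Sq θ₀ := FluidPDE.Torus.scalarL2Sq_nonneg _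
  have hB0 : 0 ≤ B := (abs_nonneg _).trans (hB 0)
  -- absolute constants: smooth-step bounds and the two symbol sockets
  obtain ⟨C, hC0, hC₁, hC₂⟩ := Literature.Analysis.Calculus.exists_abs_deriv_and_deriv_deriv_smoothTransition_le
  obtain ⟨CS, hCS0, hS⟩ := exists_fibre_data_symProdS_H
  obtain ⟨CM, hCM0, hM⟩ := exists_fibre_data_symProdM_H_sq
  -- the majorants (uniform constants)
  obtain ⟨AX, hAX0, hAX⟩ := exists_errX_bound (γ := P.γ) (γb := P.γ) (L₀ := L₀) (δ₀ := P.δ₀) (C₁ := C) (C₂ := C)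
    (Co := CS) (Cn := CM) (Mb := Real.sqrt (2 * Real.log (2000 * ((1 + P.γ) ^ 2 + 1)))) (r := (P.γ ^ 2 - 3)) (ρ := ((P.γ ^ 2 - 5 / 2) / (1 + 1 / 250) ^ 2 - 1 / (2 * (1 + 1 / 250) * L₀)))
    (Θ₀ := Real.sqrt (max (16 / ((P.γ ^ 2 - 5 / 2) / (1 + 1 / 250) ^ 2 - 1 / (2 * (1 + 1 / 250) * L₀))) (1 / 2))) (c := 3 * L₀ / 1000) hγ0 hγ0 hL0 hδ₀ hC0 hC0 hCS0
    hCM0 hMb0 (by positivity) hr1.le hρ0 hρr2 hΘpos.le hΘlt1.le hΘ16 hΘhalf hG2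
  obtain ⟨AY, hAY0, hAY⟩ := exists_errY_bound (γb := P.γ) (L₀ := L₀) (δ₀ := P.δ₀) (C₁ := C) (C₂ := C) (Cn := CM)
    (Mb := Real.sqrt (2 * Real.log (2000 * ((1 + P.γ) ^ 2 + 1)))) (ρ := ((P.γ ^ 2 - 5 / 2) / (1 + 1 / 250) ^ 2 - 1 / (2 * (1 + 1 / 250) * L₀))) (Θ₀ := Real.sqrt (max (16 / ((P.γ ^ 2 - 5 / 2) / (1 + 1 / 250) ^ 2 - 1 / (2 * (1 + 1 / 250) * L₀))) (1 / 2)))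
    (E₀ := FluidPDE.Torus.scalarL2Sq θ₀) (B := B) hγ0 hL0 hδ₀ hC0 hC0 hCM0 hMb0 hρ0
    hΘpos.le hΘlt1.le hΘ16 hΘhalf hE0 hB0
  obtain ⟨K₀, hK₀0, hK₀⟩ := exists_pow_mul_pow_le hΘpos.le hΘθ 2
  refine ⟨AX * Real.sqrt (FluidPDE.Torus.scalarL2Sq θ₀) * K₀, AY * K₀, by positivity, by positivity, ?_⟩
  intro κ hκ w hw h0 j _ hj
  -- the phase data
  have hκ0 : 0 < κ := hκ.1
  have hκr : κ * (P.γ ^ 2 - 3) ^ (2 * j) ≤ 1 := kappa_mul_rate_pow_le_one hr1 hκ0 hκ.2 hj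
  have hNj : P.N j ≠ 0 := N_ne_zero P hN₀ hρN j
  have hLj := L_pos hγ hγ' hL₀ j
  have hwj := w_pos hγ hγ' hL₀ j
  have hRj := R_pos (γ := P.γ) hL₀ j
  have hR'j := R'_pos hγ hγ' hL₀ j
  have hB' : ∀ x, |w 0 x| ≤ B := fun x => by rw [h0]; exact hB x
  -- the envelope radius against the cut-off width
  have hRw0 : 0 ≤ 2 * L₀ * ((1 + P.γ) ^ 2 + 1) ^ j + L₀ * ((P.γ ^ 2 - 5 / 2) / (1 + 1 / 250) ^ 2 - 1 / (2 * (1 + 1 / 250) * L₀)) ^ j / (20 * P.γ * (1 + 1 / 250)) := by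
    positivity
  have hRw : (2 * L₀ * ((1 + P.γ) ^ 2 + 1) ^ j + L₀ * ((P.γ ^ 2 - 5 / 2) / (1 + 1 / 250) ^ 2 - 1 / (2 * (1 + 1 / 250) * L₀)) ^ j / (20 * P.γ * (1 + 1 / 250))) *
      (1 / (1000 * ((1 + P.γ) ^ 2 + 1) ^ j)) ≤ 3 * L₀ / 1000 := by
    have hGj : 0 < ((1 + P.γ) ^ 2 + 1) ^ j := by positivity
    have hρG : ((P.γ ^ 2 - 5 / 2) / (1 + 1 / 250) ^ 2 - 1 / (2 * (1 + 1 / 250) * L₀)) ^ j ≤ ((1 + P.γ) ^ 2 + 1) ^ j := pow_le_pow_left₀ hρ0.le (rho_le_Gamma hγ hL₀) j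
    have hw1 : L₀ * ((P.γ ^ 2 - 5 / 2) / (1 + 1 / 250) ^ 2 - 1 / (2 * (1 + 1 / 250) * L₀)) ^ j / (20 * P.γ * (1 + 1 / 250)) ≤ L₀ * ((1 + P.γ) ^ 2 + 1) ^ j := by
      rw [div_le_iff₀ (by positivity)]
      have h1 : L₀ * ((P.γ ^ 2 - 5 / 2) / (1 + 1 / 250) ^ 2 - 1 / (2 * (1 + 1 / 250) * L₀)) ^ j ≤ L₀ * ((1 + P.γ) ^ 2 + 1) ^ j := mul_le_mul_of_nonneg_left hρG hL0.le
      have h2 : L₀ * ((1 + P.γ) ^ 2 + 1) ^ j ≤ L₀ * ((1 + P.γ) ^ 2 + 1) ^ j * (20 * P.γ * (1 + 1 / 250)) :=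
        le_mul_of_one_le_right (by positivity) (by linarith only [hγ])
      exact h1.trans h2
    calc (2 * L₀ * ((1 + P.γ) ^ 2 + 1) ^ j + L₀ * ((P.γ ^ 2 - 5 / 2) / (1 + 1 / 250) ^ 2 - 1 / (2 * (1 + 1 / 250) * L₀)) ^ j / (20 * P.γ * (1 + 1 / 250))) * (1 / (1000 * ((1 + P.γ) ^ 2 + 1) ^ j))
        ≤ (3 * L₀ * ((1 + P.γ) ^ 2 + 1) ^ j) * (1 / (1000 * ((1 + P.γ) ^ 2 + 1) ^ j)) :=
          mul_le_mul_of_nonneg_right (by linarith only [hw1]) (by positivity)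
      _ = 3 * L₀ / 1000 := by field_simp
  -- the two majorants at phase `j`
  have hX := hAX j κ (Real.sqrt (2 * Real.log (2000 * ((1 + P.γ) ^ 2 + 1) ^ j)))
    (2 * L₀ * ((1 + P.γ) ^ 2 + 1) ^ j + L₀ * ((P.γ ^ 2 - 5 / 2) / (1 + 1 / 250) ^ 2 - 1 / (2 * (1 + 1 / 250) * L₀)) ^ j / (20 * P.γ * (1 + 1 / 250))) (tHalf j) _ _ hκ0.le hκr (M_nonneg P.γ j)
    (M_le P.γ j) (M_sq_le P.γ j) hRw0 hRw (tHalf_pos j).le (tHalf_le_one j) rfl rfl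
  have hY := hAY j (Real.sqrt (2 * Real.log (2000 * ((1 + P.γ) ^ 2 + 1) ^ j))) _ (M_nonneg P.γ j) (M_le P.γ j)
    (M_sq_le P.γ j) rfl
  have hΦK := hK₀ j
  -- the concrete H half-slot at phase `j`
  have hstep := cascade_ledger_step_H_concrete P hγ0 hδ₀ hd0 j hNj
    (ε := 1 / (1000 * ((1 + P.γ) ^ 2 + 1) ^ j)) (M := Real.sqrt (2 * Real.log (2000 * ((1 + P.γ) ^ 2 + 1) ^ j)))
    (C₁ := C) (C₂ := C) (eps_pos P.γ j) (eps_le_sixth P.γ j) (gamma_mul_eps_le hγ hγ' j) (one_le_M P.γ j)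
    (exp_neg_M_sq_le P.γ j) (M_mul_delta_le P hγ hγ' hδ₀ hδ₀' hd j) hC₁ hC₂
    (c₁ := 2 * C * (Real.sqrt (2 * Real.log (2000 * ((1 + P.γ) ^ 2 + 1) ^ j)) + 4) * (2 * Real.pi * P.N j / P.δ j))
    (c₂ := (4 * C * (Real.sqrt (2 * Real.log (2000 * ((1 + P.γ) ^ 2 + 1) ^ j)) + 4) ^ 2 + 2 * C * (2 * Real.sqrt (2 * Real.log (2000 * ((1 + P.γ) ^ 2 + 1) ^ j)) ^ 2 + 33)) * (2 * Real.pi * P.N j / P.δ j) ^ 2)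
    rfl rfl
    (εs := 1 / 250) (εa := 1 / 20) (a := 13 / 10) (a₂ := 29 / 20) (by norm_num) (by norm_num) hLj hRj hwj hwj hwj
    (aperture_H hγ hγ' hL₀ j) (envelope_H (γ := P.γ) (L₀ := L₀) j) hCS0 hCM0
    (fun n => hS hγ0 (by norm_num) (by norm_num) (by norm_num) hLj hRj hwj hwj (w_mul_le_S hγ hγ' hL₀ j) le_rfl n)
    (fun n t₀ => hM hγ0.le (by norm_num) (by norm_num) (by norm_num) (div_pos hLj (by norm_num)) hR'j hwj hwj
      (w_mul_le_M hγ j) le_rfl n t₀)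
    hκ0.le hw hB'
  have htH0 : 0 < tHalf j := tHalf_pos j
  have hδj : 0 < P.δ j := P.δ_pos hδ₀ hd0 j
  have hEw : 0 ≤ FluidPDE.Torus.scalarL2Sq (w 0) := FluidPDE.Torus.scalarL2Sq_nonneg _
  refine ⟨_, _, ?_, ?_, ?_, ?_, hstep.trans (le_of_eq (add_assoc _ _ _))⟩
  · clear hstep hX hY hΦK hRw hRw0 hw hB' hB hAX hAY hK₀ hS hM hC₁ hC₂
    positivity
  · clear hstep hY hRw hRw0 hw hB' hS hM hC₁ hC₂ hAX hAY hK₀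
    rw [h0, Lambda_eq P hN₀ hρN hd hδ₀ j]
    calc _ ≤ AX * (((j : ℝ) + 1) ^ 2 * Real.sqrt (max (16 / ((P.γ ^ 2 - 5 / 2) / (1 + 1 / 250) ^ 2 -
            1 / (2 * (1 + 1 / 250) * L₀))) (1 / 2)) ^ j) * Real.sqrt (FluidPDE.Torus.scalarL2Sq θ₀) :=
          mul_le_mul_of_nonneg_right hX (Real.sqrt_nonneg _)
      _ ≤ AX * (K₀ * Real.sqrt (Real.sqrt (max (16 / ((P.γ ^ 2 - 5 / 2) / (1 + 1 / 250) ^ 2 -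
            1 / (2 * (1 + 1 / 250) * L₀))) (1 / 2))) ^ j) * Real.sqrt (FluidPDE.Torus.scalarL2Sq θ₀) := by gcongr
      _ = _ := by ring
  · clear hstep hX hY hΦK hRw hRw0 hw hB' hAX hAY hK₀ hS hM hC₁ hC₂
    positivity
  · clear hstep hX hRw hRw0 hw hB' hS hM hC₁ hC₂ hAX hAY hK₀
    rw [h0, Lambda_eq P hN₀ hρN hd hδ₀ j, delta_eq P hd j]
    calc _ ≤ AY * (((j : ℝ) + 1) ^ 2 * Real.sqrt (max (16 / ((P.γ ^ 2 - 5 / 2) / (1 + 1 / 250) ^ 2 -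
            1 / (2 * (1 + 1 / 250) * L₀))) (1 / 2)) ^ j) := hY
      _ ≤ AY * (K₀ * Real.sqrt (Real.sqrt (max (16 / ((P.γ ^ 2 - 5 / 2) / (1 + 1 / 250) ^ 2 -
            1 / (2 * (1 + 1 / 250) * L₀))) (1 / 2))) ^ j) := by gcongr
      _ = _ := by ring

end Cascade

end Summit.AnomalousDissipation.AnomalousDissipation.Theorems.SawtoothPulseCascade.K1Ledger
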